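import Mathlib
import HarnessLib
import Summits.Ventures.LatticeQCDFlow.Scaling.AcceptanceJensenFloorIntegral
import Summits.Ventures.LatticeQCDFlow.TrivializingMaps.CouplingKLAnyGroup
import Summits.Ventures.LatticeQCDFlow.TrivializingMaps.SpecificHeatAnyGroup

/-!
# LatticeQCDFlow / Scaling — a GLOBAL acceptance floor for coupling transfer:
# `acc(β₀ → β) ≥ exp(−D(μ_{β₀}‖μ_β) − |β − β₀|·s(β₀))`, `s(β₀) = ½E_{β₀⊗β₀}|S − S′|`

HONEST FRAMING: exact (Metropolis-corrected) sampling algorithms for lattice gauge theory;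
figures of merit are autocorrelation/cost numbers at stated couplings and volumes; no
continuum-physics claim.

Venture `LatticeQCDFlow` (cell pub-lqcd), topic `Scaling`; FANOUT row 3 (`s0-u1-a`, S0-B
implementation A, GEN-18).  NEW WORK of the cell (assembly), not a published result; NO definition is
introduced.  Parents (all in the tree): row 3's general-space JENSEN FLOOR
`Scaling/AcceptanceJensenFloorIntegral` (GEN-11: `acc ≥ exp(E_ν[log w] − ½E_{ν⊗ν}|log w − log w′|)`);
lean-2's `TrivializingMaps/CouplingKLAnyGroup` (`D(μ_a‖μ_b) = ψ(b) − ψ(a) + (b − a)⟨S⟩_a`,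
`ψ = cgf(−S_W) under D[U]`) and `TrivializingMaps/SpecificHeatAnyGroup` (`μ_t = D[U].tilted(t·(−S_W))`,
`ψ″ = Var`); Mathlib's `integral_exp_tilted`.

Setting: a flow PERFECTLY trained at `β₀` (its proposal law IS `μ_{β₀} = wilsonMeasure ρ β₀`) re-used
as an exact independence sampler at the target coupling `β`; the importance weight
`w = e^{−(β−β₀)S}·Z(β₀)/Z(β)` has a log AFFINE in the action, so the Jensen floor's two monitors are
the relative entropy `D(μ_{β₀}‖μ_β)` and `|β − β₀|` times the strong-coupling slope
`s(β₀) = ½E_{β₀⊗β₀}|S − S′|` of `Scaling/IdentityFlowAcceptanceStrongCoupling`: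

* `integral_exp_neg_mul_wilsonAction_wilsonMeasure` — `∫ e^{−δS} dμ_{β₀} = exp(ψ(β₀+δ) − ψ(β₀))`;
* **`wilsonTransfer_exp_le_meanAccept`** — for ALL real `β₀, β`, every compact second-countable `G`,
  continuous `ρ`, `d`, `L`:  `exp(−D(μ_{β₀}‖μ_β) − |β − β₀|·s(β₀)) ≤ acc(β₀ → β)`
  (`D` = Mathlib's `klDiv`, as a real number);
* **`wilsonTransfer_one_sub_le_meanAccept`** — the linear form `1 − D(μ_{β₀}‖μ_β) − |β − β₀|·s(β₀) ≤ acc`.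

Relation to the tree (value-free): lean-2's `TrivializingMaps/CouplingLadderLawAnyGroup.wilson_swapAcc_ge`
gives the floor `exp(−|β−β₀|·√(Var_{β₀} + Var_β + (⟨S⟩_{β₀} − ⟨S⟩_β)²))` for the same acceptance (swap =
independence Metropolis between the two couplings).  The present floor trades the target-side variance
for the relative entropy (second order in `β − β₀`) and carries the FIRST-order constant `s(β₀)`, which is
the exact one-sided slope of the acceptance (`Scaling/AcceptanceCouplingKink`) and is `≤ √(Var_{β₀}/3)`
(`Scaling/WilsonTransferSlopeHeatCapacity`).  NOT CLAIMED: sharpness; any value at the cell's `(β, L)`;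
nothing re-scored.
-/

noncomputable section

namespace Summit.Ventures.LatticeQCDFlow.Theory2

open MeasureTheory Real Set ProbabilityTheory Filter Topology InformationTheory
open Literature.MathematicalPhysics.QuantumFieldTheory
open Literature.MathematicalPhysics.QuantumFieldTheory.Luscher2010 (trivialMeasure)
open Summit.Ventures.LatticeQCDFlow.TrivializingMaps (toReal_klDiv_wilsonMeasure wilsonMeasure_eq_tilted_neg)

variable {d L N : ℕ} [NeZero L] {G : Type*} [Group G] [TopologicalSpace G] [IsTopologicalGroup G]
  [CompactSpace G] [MeasurableSpace G] [BorelSpace G] [SecondCountableTopology G]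
  (ρ : G →* Matrix (Fin N) (Fin N) ℂ)

/-- **`∫ e^{−δS} dμ_{β₀} = exp(ψ(β₀ + δ) − ψ(β₀))`** with `ψ = cgf(−S_W)` under `D[U]` (Mathlib's
`integral_exp_tilted` at `μ_{β₀} = D[U].tilted(β₀·(−S_W))`). [folklore] -/
theorem integral_exp_neg_mul_wilsonAction_wilsonMeasure (hρ : Continuous ρ) (β₀ δ : ℝ) :
    ∫ U, Real.exp (-δ * wilsonAction ρ U) ∂(wilsonMeasure (d := d) (L := L) ρ β₀)
      = Real.exp (cgf (fun U => -wilsonAction ρ U) (trivialMeasure G d L) (β₀ + δ)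
          - cgf (fun U => -wilsonAction ρ U) (trivialMeasure G d L) β₀) := by
  haveI : IsProbabilityMeasure (trivialMeasure G d L) := by unfold trivialMeasure; infer_instance
  have hint : ∀ t : ℝ, Integrable (fun U : GaugeConfig d L G => Real.exp (t * -wilsonAction ρ U))
      (trivialMeasure G d L) := fun t => by
    unfold trivialMeasure
    simpa only [neg_mul, mul_neg] using integrable_exp_mul_wilsonAction ρ hρ (-t)
      (Measure.pi fun _ : Edge d L => haarProbability G)
  rw [wilsonMeasure_eq_tilted_neg ρ hρ β₀]
  have h := integral_exp_tilted (μ := trivialMeasure G d L)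
    (fun U : GaugeConfig d L G => β₀ * -wilsonAction ρ U) (fun U => δ * -wilsonAction ρ U)
  have e : (fun U : GaugeConfig d L G => Real.exp (-δ * wilsonAction ρ U))
      = fun U => Real.exp (δ * -wilsonAction ρ U) := by
    funext U; ring_nf
  rw [e, h, Real.exp_sub, exp_cgf (hint _), exp_cgf (hint _), mgf, mgf]
  congr 1
  refine integral_congr_ae (ae_of_all _ fun U => ?_)
  simp only [Pi.add_apply]
  ring_nf

/-- **GLOBAL JENSEN FLOOR FOR COUPLING TRANSFER**: for every `β₀, β`,
`exp(−D(μ_{β₀}‖μ_β) − |β − β₀|·½E_{β₀⊗β₀}|S − S′|) ≤ acc(β₀ → β)`, where `acc(β₀ → β)` is the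
equilibrium acceptance of the exact sampler proposing from `μ_{β₀}` against `μ_β` (the form of row 3's
`Scaling/WilsonCouplingTransferMonotone`) and `D` is Mathlib's `klDiv`. [ours] -/
theorem wilsonTransfer_exp_le_meanAccept (hρ : Continuous ρ) (β₀ β : ℝ) :
    Real.exp (-(klDiv (wilsonMeasure (d := d) (L := L) ρ β₀) (wilsonMeasure (d := d) (L := L) ρ β)).toReal
        - |β - β₀| * (1 / 2 * ∫ U, ∫ U', |wilsonAction ρ U - wilsonAction ρ U'|
          ∂(wilsonMeasure (d := d) (L := L) ρ β₀) ∂(wilsonMeasure (d := d) (L := L) ρ β₀)))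
      ≤ ∫ U, ∫ U',
        min (Real.exp (-(β - β₀) * wilsonAction ρ U)
            / ∫ V, Real.exp (-(β - β₀) * wilsonAction ρ V) ∂(wilsonMeasure (d := d) (L := L) ρ β₀))
          (Real.exp (-(β - β₀) * wilsonAction ρ U')
            / ∫ V, Real.exp (-(β - β₀) * wilsonAction ρ V) ∂(wilsonMeasure (d := d) (L := L) ρ β₀))
        ∂(wilsonMeasure (d := d) (L := L) ρ β₀) ∂(wilsonMeasure (d := d) (L := L) ρ β₀) := by
  haveI := isProbabilityMeasure_wilsonMeasure (d := d) (L := L) (G := G) ρ hρ β₀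
  set μ₀ := wilsonMeasure (d := d) (L := L) (G := G) ρ β₀ with hμ₀
  set δ : ℝ := β - β₀ with hδ
  set ψ : ℝ → ℝ := cgf (fun U : GaugeConfig d L G => -wilsonAction ρ U) (trivialMeasure G d L) with hψ
  set Zr : ℝ := ∫ V, Real.exp (-δ * wilsonAction ρ V) ∂μ₀ with hZr
  have hSm : Measurable (wilsonAction (d := d) (L := L) (G := G) ρ) := WilsonRP.measurable_wilsonAction ρ hρ
  have hSi : Integrable (wilsonAction (d := d) (L := L) (G := G) ρ) μ₀ := integrable_wilsonAction ρ hρ μ₀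
  have hEi : Integrable (fun V => Real.exp (-δ * wilsonAction ρ V)) μ₀ :=
    integrable_exp_mul_wilsonAction ρ hρ (-δ) μ₀
  -- `Zr = exp(ψ(β) − ψ(β₀)) > 0`
  have hZr_eq : Zr = Real.exp (ψ β - ψ β₀) := by
    rw [hZr, hμ₀, integral_exp_neg_mul_wilsonAction_wilsonMeasure ρ hρ β₀ δ,
      show β₀ + δ = β by rw [hδ]; ring]
  have hZr0 : 0 < Zr := by rw [hZr_eq]; exact Real.exp_pos _
  have hlogZr : Real.log Zr = ψ β - ψ β₀ := by rw [hZr_eq, Real.log_exp]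
  -- the target density against `μ₀` and the trivial model density `1`
  set p : GaugeConfig d L G → ℝ := fun U => Real.exp (-δ * wilsonAction ρ U) / Zr with hp
  have hp0 : ∀ U, 0 < p U := fun U => div_pos (Real.exp_pos _) hZr0
  have hpm : Measurable p := (Real.measurable_exp.comp (hSm.const_mul _)).div_const _
  have hpi : Integrable p μ₀ := hEi.div_const _
  have hν : (μ₀.withDensity fun _ : GaugeConfig d L G => ENNReal.ofReal (1 : ℝ)) = μ₀ := by
    rw [show (fun _ : GaugeConfig d L G => ENNReal.ofReal (1 : ℝ)) = (1 : GaugeConfig d L G → ENNReal)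
      from funext fun _ => by simp, withDensity_one]
  haveI : IsProbabilityMeasure (μ₀.withDensity fun _ : GaugeConfig d L G => ENNReal.ofReal (1 : ℝ)) := by
    rw [hν]; infer_instance
  have hlogp : ∀ U, Real.log (p U / 1) = -δ * wilsonAction ρ U - Real.log Zr := fun U => by
    rw [div_one, hp]
    simp only
    rw [Real.log_div (Real.exp_pos _).ne' hZr0.ne', Real.log_exp]
  have hℓi : Integrable (fun U => Real.log (p U / (fun _ : GaugeConfig d L G => (1 : ℝ)) U))
      (μ₀.withDensity fun U => ENNReal.ofReal ((fun _ : GaugeConfig d L G => (1 : ℝ)) U)) := by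
    simp only
    rw [hν]
    refine ((hSi.const_mul (-δ)).sub (integrable_const (Real.log Zr))).congr
      (ae_of_all _ fun U => ?_)
    simp only [Pi.sub_apply]
    rw [hlogp U]
  -- the Jensen floor at `(μ₀, p, q ≡ 1)`
  have hJ := exp_integral_log_sub_half_mad_le_meanAccept (μ := μ₀) (p := p)
    (q := fun _ : GaugeConfig d L G => (1 : ℝ)) hp0 hpm hpi (fun _ => one_pos) measurable_const
    (integrable_const _) hℓi
  simp only [mul_one] at hJ
  rw [hν] at hJ
  -- evaluate the two monitors
  have hI1 : ∫ U, Real.log (p U / 1) ∂μ₀ = -(ψ β - ψ β₀ + δ * ∫ U, wilsonAction ρ U ∂μ₀) := by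
    simp_rw [hlogp]
    rw [integral_sub (hSi.const_mul _) (integrable_const _), integral_const_mul, integral_const,
      probReal_univ, one_smul, hlogZr]
    ring
  have hI2 : ∫ U, ∫ U', |Real.log (p U / 1) - Real.log (p U' / 1)| ∂μ₀ ∂μ₀
      = |δ| * ∫ U, ∫ U', |wilsonAction ρ U - wilsonAction ρ U'| ∂μ₀ ∂μ₀ := by
    simp_rw [hlogp]
    have e : ∀ U U' : GaugeConfig d L G,
        |-δ * wilsonAction ρ U - Real.log Zr - (-δ * wilsonAction ρ U' - Real.log Zr)|
          = |δ| * |wilsonAction ρ U - wilsonAction ρ U'| := fun U U' => by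
      rw [show -δ * wilsonAction ρ U - Real.log Zr - (-δ * wilsonAction ρ U' - Real.log Zr)
        = -δ * (wilsonAction ρ U - wilsonAction ρ U') by ring, abs_mul, abs_neg]
    simp_rw [e, integral_const_mul]
  rw [hI1, hI2] at hJ
  -- the first monitor is the relative entropy (lean-2's `toReal_klDiv_wilsonMeasure`)
  have hKL : (klDiv μ₀ (wilsonMeasure (d := d) (L := L) ρ β)).toReal
      = ψ β - ψ β₀ + δ * ∫ U, wilsonAction ρ U ∂μ₀ := by
    rw [hμ₀, toReal_klDiv_wilsonMeasure ρ hρ β₀ β]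
  rw [hKL]
  have e3 : -(ψ β - ψ β₀ + δ * ∫ U, wilsonAction ρ U ∂μ₀)
      - |δ| * (∫ U, ∫ U', |wilsonAction ρ U - wilsonAction ρ U'| ∂μ₀ ∂μ₀) / 2
      = -(ψ β - ψ β₀ + δ * ∫ U, wilsonAction ρ U ∂μ₀)
        - |δ| * (1 / 2 * ∫ U, ∫ U', |wilsonAction ρ U - wilsonAction ρ U'| ∂μ₀ ∂μ₀) := by ring
  rw [e3] at hJ
  exact hJ

/-- **LINEAR FORM**: `1 − D(μ_{β₀}‖μ_β) − |β − β₀|·½E_{β₀⊗β₀}|S − S′| ≤ acc(β₀ → β)` for every `β₀, β`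
(`1 − x ≤ e^{−x}`). [ours] -/
theorem wilsonTransfer_one_sub_le_meanAccept (hρ : Continuous ρ) (β₀ β : ℝ) :
    1 - (klDiv (wilsonMeasure (d := d) (L := L) ρ β₀) (wilsonMeasure (d := d) (L := L) ρ β)).toReal
        - |β - β₀| * (1 / 2 * ∫ U, ∫ U', |wilsonAction ρ U - wilsonAction ρ U'|
          ∂(wilsonMeasure (d := d) (L := L) ρ β₀) ∂(wilsonMeasure (d := d) (L := L) ρ β₀))
      ≤ ∫ U, ∫ U',
        min (Real.exp (-(β - β₀) * wilsonAction ρ U)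
            / ∫ V, Real.exp (-(β - β₀) * wilsonAction ρ V) ∂(wilsonMeasure (d := d) (L := L) ρ β₀))
          (Real.exp (-(β - β₀) * wilsonAction ρ U')
            / ∫ V, Real.exp (-(β - β₀) * wilsonAction ρ V) ∂(wilsonMeasure (d := d) (L := L) ρ β₀))
        ∂(wilsonMeasure (d := d) (L := L) ρ β₀) ∂(wilsonMeasure (d := d) (L := L) ρ β₀) := by
  refine le_trans ?_ (wilsonTransfer_exp_le_meanAccept ρ hρ β₀ β)
  have h := Real.add_one_le_exp
    (-(klDiv (wilsonMeasure (d := d) (L := L) ρ β₀) (wilsonMeasure (d := d) (L := L) ρ β)).toReal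
        - |β - β₀| * (1 / 2 * ∫ U, ∫ U', |wilsonAction ρ U - wilsonAction ρ U'|
          ∂(wilsonMeasure (d := d) (L := L) ρ β₀) ∂(wilsonMeasure (d := d) (L := L) ρ β₀)))
  linarith

end Summit.Ventures.LatticeQCDFlow.Theory2
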